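import Literature.NumberTheory.EllipticCurves.MordellCurveThreeDescentKernel
import Mathlib.Algebra.CubicDiscriminant
import HarnessLib

/-!
# The `φ`-descent map `(X, Y) ↦ Y + B` on `Y² = X³ + B²` is a homomorphism to `F*/F*³`

Topic `NumberTheory/EllipticCurves`. Fourth file of the programme towards
`Literature.Barriers.BirchSwinnertonDyer.Cassels1964_sha_threeRank_jZero` (Cassels 1964,
*Arithmetic on curves of genus 1, VI*; see
`Literature/Barriers/BirchSwinnertonDyer/DescentDefectUnboundedCasselsProofs.lean`), and the cubic
analogue of the tree's `Literature.NumberTheory.EllipticCurves.TwoDescent`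
(`twoDescentComponent_add`, Silverman *AEC* X.1.4 / X.4.9 for `2`-isogenies). Everything here is
proved; no named facts. The field `F` is arbitrary: the homomorphism needs only `2 ≠ 0` (and
`B ≠ 0`), the exactness statement `2 ≠ 0`, `3 ≠ 0` (finite fields are the intended use: the local
analysis of Cassels' torsors at the good primes `p ≡ 1 (mod 3)`).

For `B ∈ F*` let `E'_B : Y² = X³ + B²` (`mordellCurve (B ^ 2)`), with the points `±T' = (0, ±B)`
of order `3`, and let `δ : E'_B(F) → F`, `O ↦ 1`, `(X, Y) ↦ Y + B` for `Y ≠ −B`, `−T' ↦ (2B)²`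
(`MordellDescent.cubicDescent B`; for `B = 9c` this is `MordellDescent.phiDescent c` of the
kernel file: `phiDescent_eq_cubicDescent`, proved at the end of this file) — the connecting
homomorphism
`E'(F) → H¹(F, E[φ]) = F*/F*³` of the `3`-isogeny `φ : E_{−27B²} → E'_B` with kernel `μ₃`.

* `MordellDescent.CubeUnits F = Fˣ/Fˣ³` and the total map `MordellDescent.cubeClass : F → Fˣ/Fˣ³`
  (junk value `1` at `0`); `cubeClass_mul`, `cubeClass_pow_three`, `cubeClass_eq_cubeClass_iff`.
* **The chord identity** (`prod_add_B_eq_cube`): if `P₁ = (x₁, y₁)`, `P₂ = (x₂, y₂)` are on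
  `E'_B`, not opposite, `ℓ` the slope of the chord (tangent) and `(x₃, Y_R)` the third intersection
  of the line with the curve, then `(y₁ + B)(y₂ + B)(Y_R + B) = (y₁ + B − ℓ x₁)³` — by Vieta for
  Mathlib's `addPolynomial_slope` (`(ℓ(X − x₁) + y₁)² − X³ − B² = −(X − x₁)(X − x₂)(X − x₃)`):
  `∏ (ℓ xᵢ + μ) = ℓ³e₃ + ℓ²μe₂ + ℓμ²e₁ + μ³ = μ³`, `μ = y₁ + B − ℓx₁`.
* **`δ` is a homomorphism modulo cubes** (`cubicDescentClass_add`, for `2 ≠ 0`, `B ≠ 0`):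
  `[δ(P + Q)] = [δ(P)] [δ(Q)]` in `Fˣ/Fˣ³` (case analysis over Mathlib's chord–tangent law as in
  `twoDescentComponent_add`: opposite points via `(Y + B)(B − Y) = −X³`; the generic case via the
  chord identity for `B` and for `−B`; the points `±T'` via the same identities).
* **Exactness** (`exists_pointFun_eq_of_cubicDescentClass_eq_one`, for `2 ≠ 0`, `3 ≠ 0`,
  `√−3 ∈ F`): `[δ(P')] = 1 ⇒ P' ∈ φ(E(F))`, by the explicit preimage of the kernel file in
  characteristic-free form.
* **Bridge to the kernel file** (`phiDescent_eq_cubicDescent`):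
  `phiDescent c P = cubicDescent (mordellCurve (81c²)) (9c) P`, so that the kernel theorem
  `exists_phiDescent_eq_of_torsorClass_eq_zero`, the local condition
  `torsorClass_mem_localRestrictionKer` and the present multiplicativity/exactness compose.

## References

* [Cassels1964ArithmeticVI] J. W. S. Cassels, J. reine angew. Math. 214/215 (1964) 65–70, p. 65
  ("a mapping of the multiplicative group `ℚ*` … the kernel consisting of precisely those `m`
  for which (2) has a rational point": the kernel is a subgroup — the descent values form a group).
* [SilvermanAEC2009] J. H. Silverman, *The Arithmetic of Elliptic Curves*, 2nd ed., GTM 106,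
  X.4.9 (the `2`-isogeny analogue `(X, Y) ↦ X`), Exercise 10.1.
* Template in the tree: `Literature.NumberTheory.EllipticCurves.TwoDescent`.
-/

noncomputable section

open scoped Classical

open WeierstrassCurve Polynomial

universe u

namespace Literature.NumberTheory.EllipticCurves

namespace MordellDescent

variable {F : Type u} [Field F]

/-! ## `Fˣ/Fˣ³` -/

/-- `Fˣ/Fˣ³`, the target of the `φ`-descent map (`= H¹(F, μ₃)` when `char F ≠ 3`). [folklore] -/
abbrev CubeUnits (F : Type u) [Field F] : Type u := Fˣ ⧸ (powMonoidHom 3 : Fˣ →* Fˣ).range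

/-- The class of `a ∈ F` in `Fˣ/Fˣ³` (junk value `1` at `a = 0`). [folklore] -/
def cubeClass (a : F) : CubeUnits F :=
  if h : a = 0 then 1 else QuotientGroup.mk (Units.mk0 a h)

/-- Unfolding `cubeClass` at a non-zero element. [folklore] -/
theorem cubeClass_of_ne_zero {a : F} (h : a ≠ 0) : cubeClass a = QuotientGroup.mk (Units.mk0 a h) := by
  rw [cubeClass, dif_neg h]

/-- `cubeClass` is multiplicative on `F*`. [folklore] -/
theorem cubeClass_mul {a b : F} (ha : a ≠ 0) (hb : b ≠ 0) :
    cubeClass (a * b) = cubeClass a * cubeClass b := by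
  rw [cubeClass_of_ne_zero ha, cubeClass_of_ne_zero hb, cubeClass_of_ne_zero (mul_ne_zero ha hb),
    ← QuotientGroup.mk_mul]
  congr 1
  exact Units.ext rfl

/-- Cubes have trivial class. [folklore] -/
theorem cubeClass_pow_three (a : F) : cubeClass (a ^ 3) = 1 := by
  by_cases ha : a = 0
  · rw [ha, zero_pow three_ne_zero, cubeClass, dif_pos rfl]
  · rw [cubeClass_of_ne_zero (pow_ne_zero 3 ha), QuotientGroup.eq_one_iff]
    exact ⟨Units.mk0 a ha, Units.ext (by simp)⟩

/-- `cubeClass 1 = 1`. [folklore] -/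
@[simp] theorem cubeClass_one : cubeClass (1 : F) = 1 := by
  rw [← one_pow 3, cubeClass_pow_three]

namespace CubeUnits

/-- `Fˣ/Fˣ³` has exponent `3`: `g g g = 1`. [folklore] -/
theorem mul_mul_self (g : CubeUnits F) : g * g * g = 1 := by
  induction g using QuotientGroup.induction_on with
  | H u =>
    rw [← QuotientGroup.mk_mul, ← QuotientGroup.mk_mul, QuotientGroup.eq_one_iff]
    exact ⟨u, by rw [powMonoidHom_apply, pow_three']⟩

/-- In `Fˣ/Fˣ³` the inverse is the square. [folklore] -/
theorem inv_eq_mul_self (g : CubeUnits F) : g⁻¹ = g * g :=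
  inv_eq_of_mul_eq_one_left (mul_mul_self g)

/-! The unit group `Fˣ` carries two syntactically different `Monoid F` instance paths, so generic
`mul_one`/`one_mul` do not fire under `rw` on `CubeUnits F`; we restate them (cf. `SqUnits`). -/

/-- `a · 1 = a` on `Fˣ/Fˣ³`, restated for `rw`. [folklore] -/
protected theorem mul_one (a : CubeUnits F) : a * 1 = a := mul_one a

/-- `1 · a = a` on `Fˣ/Fˣ³`, restated for `rw`. [folklore] -/
protected theorem one_mul (a : CubeUnits F) : 1 * a = a := one_mul a

/-- Commutativity on `Fˣ/Fˣ³`, restated. [folklore] -/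
protected theorem mul_comm (a b : CubeUnits F) : a * b = b * a := mul_comm a b

/-- Associativity on `Fˣ/Fˣ³`, restated. [folklore] -/
protected theorem mul_assoc (a b c : CubeUnits F) : a * b * c = a * (b * c) := mul_assoc a b c

end CubeUnits

/-- `a w³` has the class of `a`. [folklore] -/
theorem cubeClass_mul_pow_three {a w : F} (ha : a ≠ 0) (hw : w ≠ 0) :
    cubeClass (a * w ^ 3) = cubeClass a := by
  rw [cubeClass_mul ha (pow_ne_zero 3 hw), cubeClass_pow_three, CubeUnits.mul_one]

/-- Equal classes differ by a cube: `[a] = [b] ↔ ∃ w ≠ 0, a = b w³` (`a, b ≠ 0`). [folklore] -/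
theorem cubeClass_eq_cubeClass_iff {a b : F} (ha : a ≠ 0) (hb : b ≠ 0) :
    cubeClass a = cubeClass b ↔ ∃ w : F, w ≠ 0 ∧ a = b * w ^ 3 := by
  rw [cubeClass_of_ne_zero ha, cubeClass_of_ne_zero hb, eq_comm, QuotientGroup.eq]
  constructor
  · rintro ⟨u, hu⟩
    refine ⟨u, u.ne_zero, ?_⟩
    have := congrArg Units.val hu
    simp only [powMonoidHom_apply, Units.val_pow_eq_pow_val, Units.val_mul, Units.val_inv_eq_inv_val,
      Units.val_mk0] at this
    field_simp at this
    linear_combination -this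
  · rintro ⟨w, hw, h⟩
    refine ⟨Units.mk0 w hw, Units.ext ?_⟩
    simp only [powMonoidHom_apply, Units.val_pow_eq_pow_val, Units.val_mul, Units.val_inv_eq_inv_val,
      Units.val_mk0]
    rw [h]
    field_simp

/-- `[a] = 1 ↔ a` is a cube (`a ≠ 0`). [folklore] -/
theorem cubeClass_eq_one_iff {a : F} (ha : a ≠ 0) : cubeClass a = 1 ↔ ∃ w : F, w ≠ 0 ∧ a = w ^ 3 := by
  rw [← cubeClass_one, cubeClass_eq_cubeClass_iff ha one_ne_zero]
  simp only [one_mul]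

/-- If `a b = w³` then `[b] = [a]⁻¹ = [a][a]`. [folklore] -/
theorem cubeClass_eq_mul_self_of_mul_eq_cube {a b w : F} (ha : a ≠ 0) (hb : b ≠ 0) (h : a * b = w ^ 3) :
    cubeClass b = cubeClass a * cubeClass a := by
  have h1 : cubeClass a * cubeClass b = 1 := by
    rw [← cubeClass_mul ha hb, h, cubeClass_pow_three]
  exact (eq_inv_of_mul_eq_one_right h1).trans (CubeUnits.inv_eq_mul_self _)

/-- If `a b c = w³` (all non-zero) then `[c] = ([a][b])⁻¹ = [a][b][a][b]`. [folklore] -/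
theorem cubeClass_eq_of_mul_mul_eq_cube {a b c w : F} (ha : a ≠ 0) (hb : b ≠ 0) (hc : c ≠ 0)
    (h : a * b * c = w ^ 3) : cubeClass c = (cubeClass a * cubeClass b) * (cubeClass a * cubeClass b) := by
  rw [← cubeClass_mul ha hb]
  exact cubeClass_eq_mul_self_of_mul_eq_cube (mul_ne_zero ha hb) hc h

/-! ## The curve `E'_B : Y² = X³ + B²` -/

section Curve

variable {W : WeierstrassCurve F} {B : F}

/-- The equation of `E'_B`. [folklore] -/
theorem equation_iff_of_eq (hW : W = mordellCurve (B ^ 2)) (x y : F) :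
    W.toAffine.Equation x y ↔ y ^ 2 = x ^ 3 + B ^ 2 := by
  subst hW; exact mordellCurve_equation_iff _ x y

/-- Negation on `E'_B`. [folklore] -/
theorem negY_of_eq (hW : W = mordellCurve (B ^ 2)) (x y : F) : W.toAffine.negY x y = -y := by
  subst hW; exact mordellCurve_negY _ x y

/-- On `E'_B`: `(y + B)(y − B) = x³`. [folklore] -/
theorem mul_eq_cube_of_equation (hW : W = mordellCurve (B ^ 2)) {x y : F} (h : W.toAffine.Equation x y) :
    (y + B) * (y - B) = x ^ 3 := by
  rw [equation_iff_of_eq hW] at h; linear_combination h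

/-- On `E'_B`: `y = −B` or `y = B` forces `x = 0` (in a reduced ring: `x³ = 0`). [folklore] -/
theorem x_eq_zero_of_y_eq (hW : W = mordellCurve (B ^ 2)) {x y : F} (h : W.toAffine.Equation x y)
    (hy : y = -B ∨ y = B) : x = 0 := by
  have h3 : x ^ 3 = 0 := by
    rw [← mul_eq_cube_of_equation hW h]
    rcases hy with rfl | rfl <;> ring
  exact pow_eq_zero_iff three_ne_zero |>.mp h3

/-- On `E'_B`: `x = 0` forces `y = ±B`. [folklore] -/
theorem y_eq_or_of_x_eq_zero (hW : W = mordellCurve (B ^ 2)) {x y : F} (h : W.toAffine.Equation x y)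
    (hx : x = 0) : y = B ∨ y = -B := by
  have := mul_eq_cube_of_equation hW h
  rw [hx, zero_pow three_ne_zero, mul_eq_zero] at this
  rcases this with h1 | h1
  · exact Or.inr (by linear_combination h1)
  · exact Or.inl (by linear_combination h1)

/-- **The chord identity.** For `P₁ = (x₁, y₁)`, `P₂ = (x₂, y₂)` on `E'_B`, not opposite, with
`ℓ` the slope of the chord (tangent) through them and `(x₃, Y_R)`, `Y_R = ℓ(x₃ − x₁) + y₁`
(Mathlib's `negAddY`), the third intersection of that line with the curve:
`(y₁ + B)(y₂ + B)(Y_R + B) = (y₁ + B − ℓ x₁)³`. Vieta for `addPolynomial_slope`. [folklore] -/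
theorem prod_add_B_eq_cube (hW : W = mordellCurve (B ^ 2)) {x₁ x₂ y₁ y₂ : F}
    (h₁ : W.toAffine.Equation x₁ y₁) (h₂ : W.toAffine.Equation x₂ y₂)
    (hxy : ¬(x₁ = x₂ ∧ y₁ = W.toAffine.negY x₂ y₂)) :
    (y₁ + B) * (y₂ + B) *
        (W.toAffine.negAddY x₁ x₂ y₁ (W.toAffine.slope x₁ x₂ y₁ y₂) + B) =
      (y₁ + B - W.toAffine.slope x₁ x₂ y₁ y₂ * x₁) ^ 3 := by
  subst hW
  -- Vieta from `addPolynomial_slope`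
  have hpoly := Affine.addPolynomial_slope h₁ h₂ hxy
  rw [Affine.addPolynomial_eq, Cubic.prod_X_sub_C_eq, neg_inj, Cubic.toPoly_injective] at hpoly
  simp only [mordellCurve_a₁, mordellCurve_a₂, mordellCurve_a₃, mordellCurve_a₄, mordellCurve_a₆,
    Cubic.mk.injEq] at hpoly
  obtain ⟨-, he₁, he₂, he₃⟩ := hpoly
  set ℓ := (mordellCurve (B ^ 2)).toAffine.slope x₁ x₂ y₁ y₂ with hℓ
  set x₃ := (mordellCurve (B ^ 2)).toAffine.addX x₁ x₂ ℓ with hx₃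
  -- `y₂` lies on the line: `y₂ = ℓ(x₂ − x₁) + y₁`
  have hy₂ : y₂ = ℓ * (x₂ - x₁) + y₁ := by
    by_cases hx : x₁ = x₂
    · subst hx
      have hy : y₁ ≠ (mordellCurve (B ^ 2)).toAffine.negY x₁ y₂ := fun h => hxy ⟨rfl, h⟩
      rw [Affine.Y_eq_of_Y_ne h₁ h₂ rfl hy]; ring
    · rw [hℓ, Affine.slope_of_X_ne hx]; field_simp [sub_ne_zero.mpr hx]; ring
  have hnY : (mordellCurve (B ^ 2)).toAffine.negAddY x₁ x₂ y₁ ℓ = ℓ * (x₃ - x₁) + y₁ := rfl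
  rw [hnY, hy₂]
  -- `∏ (ℓ xᵢ + μ) = ℓ³ e₃ + ℓ² μ e₂ + ℓ μ² e₁ + μ³ = μ³`, `μ = y₁ + B − ℓ x₁`
  linear_combination (ℓ * (y₁ + B - ℓ * x₁) ^ 2) * he₁ + (-(ℓ ^ 2 * (y₁ + B - ℓ * x₁))) * he₂ +
    ℓ ^ 3 * he₃

/-- `[−a] = [a]` (`−1` is a cube). [folklore] -/
theorem cubeClass_neg (a : F) : cubeClass (-a) = cubeClass a := by
  by_cases ha : a = 0
  · rw [ha, neg_zero]
  · rw [show -a = a * (-1) ^ 3 by ring, cubeClass_mul_pow_three ha (by norm_num)]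

/-- In `Fˣ/Fˣ³`: `g⁴ = g`, in the form `(g g)(g g) = g`. [folklore] -/
theorem CubeUnits.mul_self_mul_self (g : CubeUnits F) : (g * g) * (g * g) = g := by
  rw [CubeUnits.mul_assoc, ← CubeUnits.mul_assoc g g g, CubeUnits.mul_mul_self, CubeUnits.mul_one]

/-! ## The `φ`-descent map and its multiplicativity -/

variable (W) in
/-- **The `φ`-descent map** on the points of `W = E'_B : Y² = X³ + B²`, read in `F` (values
modulo `F*³`): `O ↦ 1`, `(X, Y) ↦ Y + B` for `Y ≠ −B`, and `−T' = (0, −B) ↦ (2B)²`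
(`(Y + B)(Y − B) = X³`, so `Y + B ≡ (Y − B)²` wherever both are non-zero). For `B = 9c` it is
`phiDescent c` of `MordellCurveThreeDescentKernel` (`phiDescent_eq_cubicDescent`).
[cite: Cassels1964ArithmeticVI, p. 65] -/
def cubicDescent (B : F) : W.toAffine.Point → F
  | .zero => 1
  | .some _ Y _ => if Y = -B then (2 * B) ^ 2 else Y + B

/-- `δ(O) = 1`. [folklore] -/
@[simp] theorem cubicDescent_zero (B : F) : cubicDescent W B 0 = 1 := rfl

/-- `δ` at an affine point. [folklore] -/
theorem cubicDescent_some (B : F) {x y : F} (h : W.toAffine.Nonsingular x y) :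
    cubicDescent W B (.some x y h) = if y = -B then (2 * B) ^ 2 else y + B := rfl

/-- `δ(x, y) = y + B` for `y ≠ −B`. [folklore] -/
theorem cubicDescent_some_of_ne (B : F) {x y : F} (h : W.toAffine.Nonsingular x y) (hy : y ≠ -B) :
    cubicDescent W B (.some x y h) = y + B := by
  rw [cubicDescent_some, if_neg hy]

/-- `δ(x, −B) = (2B)²`. [folklore] -/
theorem cubicDescent_some_of_eq (B : F) {x y : F} (h : W.toAffine.Nonsingular x y) (hy : y = -B) :
    cubicDescent W B (.some x y h) = (2 * B) ^ 2 := by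
  rw [cubicDescent_some, if_pos hy]

variable (W) in
/-- The `φ`-descent class `[δ(P)] ∈ Fˣ/Fˣ³`. [cite: Cassels1964ArithmeticVI, p. 65] -/
def cubicDescentClass (B : F) (P : W.toAffine.Point) : CubeUnits F :=
  cubeClass (cubicDescent W B P)

/-- `[δ(O)] = 1`. [folklore] -/
@[simp] theorem cubicDescentClass_zero (B : F) : cubicDescentClass W B 0 = 1 := by
  rw [cubicDescentClass, cubicDescent_zero, cubeClass_one]

/-- `δ` never vanishes (`2B ≠ 0`). [folklore] -/
theorem cubicDescent_ne_zero (h2B : (2 : F) * B ≠ 0) (P : W.toAffine.Point) : cubicDescent W B P ≠ 0 := by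
  rcases P with _ | ⟨x, y, h⟩
  · exact one_ne_zero
  · rw [cubicDescent_some]
    split_ifs with hy
    · exact pow_ne_zero 2 h2B
    · intro h0; exact hy (by linear_combination h0)

/-- The second point lies on the chord: `y₂ = ℓ (x₂ − x₁) + y₁` (also in the tangent case).
[folklore] -/
theorem y₂_eq_line {W : WeierstrassCurve F} {x₁ x₂ y₁ y₂ : F} (h₁ : W.toAffine.Equation x₁ y₁)
    (h₂ : W.toAffine.Equation x₂ y₂) (hxy : ¬(x₁ = x₂ ∧ y₁ = W.toAffine.negY x₂ y₂)) :
    y₂ = W.toAffine.slope x₁ x₂ y₁ y₂ * (x₂ - x₁) + y₁ := by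
  by_cases hx : x₁ = x₂
  · subst hx
    have hy : y₁ ≠ W.toAffine.negY x₁ y₂ := fun h => hxy ⟨rfl, h⟩
    rw [Affine.Y_eq_of_Y_ne h₁ h₂ rfl hy]; ring
  · rw [Affine.slope_of_X_ne hx]; field_simp [sub_ne_zero.mpr hx]; ring

/-- **The `φ`-descent map is a homomorphism `E'_B(F) → Fˣ/Fˣ³`** (`B ≠ 0`, `char F ≠ 2, 3`):
`[δ(P + Q)] = [δ(P)][δ(Q)]`. Case analysis over the chord–tangent law; in each case an explicit
`w` with `δ(P) δ(Q) = δ(P + Q) w³` is produced from the identities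
`(y₁ ± B)(y₂ ± B)(Y_R ± B) = (y₁ ± B − ℓx₁)³` (`prod_add_B_eq_cube` for `B` and `−B`) and
`(y + B)(y − B) = x³` at `P`, `Q` and the third point `R = (x₃, Y_R)` of the chord.
[cite: Cassels1964ArithmeticVI, p. 65] -/
theorem cubicDescentClass_add (hW : W = mordellCurve (B ^ 2)) (h2 : (2 : F) ≠ 0)
    (hB : B ≠ 0) (P Q : W.toAffine.Point) :
    cubicDescentClass W B (P + Q) = cubicDescentClass W B P * cubicDescentClass W B Q := by
  have h2B : (2 : F) * B ≠ 0 := mul_ne_zero h2 hB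
  have h2B2 : ((2 : F) * B) ^ 2 ≠ 0 := pow_ne_zero 2 h2B
  have hBB : B ≠ -B := fun h => h2B (by linear_combination h)
  have hnegY : ∀ x y : F, W.toAffine.negY x y = -y := negY_of_eq hW
  have hW' : W = mordellCurve ((-B) ^ 2) := by rw [neg_sq]; exact hW
  rcases P with _ | ⟨x₁, y₁, h₁⟩
  · rw [← Affine.Point.zero_def, zero_add, cubicDescentClass_zero, CubeUnits.one_mul]
  rcases Q with _ | ⟨x₂, y₂, h₂⟩
  · rw [← Affine.Point.zero_def, add_zero, cubicDescentClass_zero, CubeUnits.mul_one]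
  have hc₁ := mul_eq_cube_of_equation hW h₁.left
  have hc₂ := mul_eq_cube_of_equation hW h₂.left
  -- `y + B ≠ 0` iff `y ≠ -B`; `y - B = 0` forces `x = 0`
  have hadd : ∀ {y : F}, y ≠ -B → y + B ≠ 0 := fun hy h => hy (by linear_combination h)
  simp only [cubicDescentClass]
  by_cases hopp : x₁ = x₂ ∧ y₁ = W.toAffine.negY x₂ y₂
  · /- `Q = −P`: `P + Q = O` -/
    rw [Affine.Point.add_of_Y_eq hopp.1 hopp.2, cubicDescent_zero, cubeClass_one]
    obtain ⟨hx, hy⟩ := hopp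
    rw [hnegY] at hy
    rw [cubicDescent_some, cubicDescent_some]
    by_cases hy₁ : y₁ = -B
    · -- `P = −T'`, `Q = T'`: `(2B)² · 2B = (2B)³`
      have hy₂ : y₂ = B := by linear_combination hy - hy₁
      rw [if_pos hy₁, if_neg (by rw [hy₂]; exact hBB), hy₂, ← cubeClass_mul h2B2 (by
        rw [← two_mul]; exact h2B), show (2 * B) ^ 2 * (B + B) = (2 * B) ^ 3 by ring, cubeClass_pow_three]
    by_cases hy₂ : y₂ = -B
    · -- `P = T'`, `Q = −T'`
      have hy₁' : y₁ = B := by linear_combination hy - hy₂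
      rw [if_neg hy₁, if_pos hy₂, hy₁', ← cubeClass_mul (by rw [← two_mul]; exact h2B) h2B2,
        show (B + B) * (2 * B) ^ 2 = (2 * B) ^ 3 by ring, cubeClass_pow_three]
    · -- generic opposite points: `(y₁ + B)(y₂ + B) = (y₁ + B)(B − y₁) = (−x₁)³`
      rw [if_neg hy₁, if_neg hy₂, ← cubeClass_mul (hadd hy₁) (hadd hy₂),
        show (y₁ + B) * (y₂ + B) = (-x₁) ^ 3 by linear_combination -hc₁ + (y₁ + B) * hy, cubeClass_pow_three]
  · /- the chord (tangent) through `P`, `Q`, and its third point `R = (x₃, Y)` -/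
    have h4 : (4 : F) ≠ 0 := by rw [show (4 : F) = 2 * 2 by norm_num]; exact mul_ne_zero h2 h2
    have hline := y₂_eq_line h₁.left h₂.left hopp
    have hR := Affine.equation_negAdd h₁.left h₂.left hopp
    have Cp := prod_add_B_eq_cube hW h₁.left h₂.left hopp
    have Cm := prod_add_B_eq_cube hW' h₁.left h₂.left hopp
    have hYd : W.toAffine.addY x₁ x₂ y₁ (W.toAffine.slope x₁ x₂ y₁ y₂) =
        -(W.toAffine.negAddY x₁ x₂ y₁ (W.toAffine.slope x₁ x₂ y₁ y₂)) := by
      rw [show W.toAffine.addY x₁ x₂ y₁ (W.toAffine.slope x₁ x₂ y₁ y₂) =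
        W.toAffine.negY (W.toAffine.addX x₁ x₂ (W.toAffine.slope x₁ x₂ y₁ y₂))
          (W.toAffine.negAddY x₁ x₂ y₁ (W.toAffine.slope x₁ x₂ y₁ y₂)) from rfl, hnegY]
    have hYR : W.toAffine.negAddY x₁ x₂ y₁ (W.toAffine.slope x₁ x₂ y₁ y₂) =
        W.toAffine.slope x₁ x₂ y₁ y₂ * (W.toAffine.addX x₁ x₂ (W.toAffine.slope x₁ x₂ y₁ y₂) - x₁) + y₁ :=
      rfl
    rw [Affine.Point.add_some hopp, cubicDescent_some, cubicDescent_some, cubicDescent_some, hYd]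
    have hc₃ := mul_eq_cube_of_equation hW hR
    -- name the slope `ℓ`, the third point `(x₃, Y)`
    generalize hℓ : W.toAffine.slope x₁ x₂ y₁ y₂ = ℓ at hline hR Cp Cm hc₃ hYR ⊢
    generalize hx₃ : W.toAffine.addX x₁ x₂ ℓ = x₃ at hR hc₃ hYR ⊢
    generalize hYdef : W.toAffine.negAddY x₁ x₂ y₁ ℓ = Y at hR Cp Cm hc₃ hYR ⊢
    simp only [neg_inj, neg_add_eq_sub]
    by_cases hy₁ : y₁ = -B
    · have hx₁ : x₁ = 0 := x_eq_zero_of_y_eq hW h₁.left (Or.inl hy₁)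
      by_cases hy₂ : y₂ = -B
      · /- `P = Q = −T'`: the tangent at `−T'` is horizontal, `P + Q = T'` -/
        have hx₂ : x₂ = 0 := x_eq_zero_of_y_eq hW h₂.left (Or.inl hy₂)
        have hℓ0 : ℓ = 0 := by
          rw [← hℓ, Affine.slope_of_Y_ne (hx₁.trans hx₂.symm) (fun h => hopp ⟨hx₁.trans hx₂.symm, h⟩)]
          subst hW
          rw [hx₁, hy₁, mordellCurve_a₁, mordellCurve_a₂, mordellCurve_a₄]; simp
        have hYv : Y = -B := by rw [hYR, hℓ0, hy₁]; ring
        rw [if_pos hy₁, if_pos hy₂, if_neg (by rw [hYv]; exact fun h => hBB h.symm), hYv,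
          show B - -B = 2 * B by ring, ← cubeClass_mul h2B2 h2B2,
          show (2 * B) ^ 2 * (2 * B) ^ 2 = 2 * B * (2 * B) ^ 3 by ring, cubeClass_mul_pow_three h2B h2B]
      · /- `P = −T'`, `Q` generic: `(2B)² (y₂ + B) = (B − Y)(−x₂)³` -/
        have hx₂ : x₂ ≠ 0 := by
          intro hx₂
          rcases y_eq_or_of_x_eq_zero hW h₂.left hx₂ with h | h
          · exact hopp ⟨hx₁.trans hx₂.symm, by rw [hnegY, h, hy₁]⟩
          · exact hy₂ h
        -- `Cm`: `(−2B)(y₂ − B)(Y − B) = (−2B)³`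
        have key0 : (y₂ - B) * (Y - B) = 4 * B ^ 2 := by
          have e : (-2 * B) * ((y₂ - B) * (Y - B) - 4 * B ^ 2) = 0 := by
            rw [hy₁, hx₁] at Cm; linear_combination Cm
          exact sub_eq_zero.mp ((mul_eq_zero.mp e).resolve_left (by
            intro h; exact h2B (by linear_combination -h)))
        have hYB : Y ≠ B := by
          intro h; rw [h, sub_self, mul_zero] at key0
          exact hB (pow_eq_zero_iff two_ne_zero |>.mp ((mul_eq_zero.mp key0.symm).resolve_left h4))
        have key : (2 * B) ^ 2 * (y₂ + B) = (B - Y) * (-x₂) ^ 3 := by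
          rw [neg_pow, show ((-1 : F)) ^ 3 = -1 by norm_num, ← hc₂]
          linear_combination -(y₂ + B) * key0
        rw [if_pos hy₁, if_neg hy₂, if_neg hYB, ← cubeClass_mul h2B2 (hadd hy₂), key,
          cubeClass_mul_pow_three (sub_ne_zero.mpr (Ne.symm hYB)) (neg_ne_zero.mpr hx₂)]
    by_cases hy₂ : y₂ = -B
    · /- `Q = −T'`, `P` generic: `(y₁ + B)(2B)² = (B − Y)(−x₁)³` -/
      have hx₂ : x₂ = 0 := x_eq_zero_of_y_eq hW h₂.left (Or.inl hy₂)
      have hx₁ : x₁ ≠ 0 := by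
        intro hx₁
        rcases y_eq_or_of_x_eq_zero hW h₁.left hx₁ with h | h
        · exact hopp ⟨hx₁.trans hx₂.symm, by rw [hnegY, h, hy₂, neg_neg]⟩
        · exact hy₁ h
      -- the line through `P` and `Q = (0, −B)`: `y₁ − ℓ x₁ = −B`
      have hν : y₁ - ℓ * x₁ = -B := by rw [hx₂, hy₂] at hline; linear_combination -hline
      have key0 : (y₁ - B) * (Y - B) = 4 * B ^ 2 := by
        have hμ : y₁ + -B - ℓ * x₁ = -2 * B := by linear_combination hν
        have e : (-2 * B) * ((y₁ - B) * (Y - B) - 4 * B ^ 2) = 0 := by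
          rw [hy₂, hμ] at Cm
          linear_combination Cm
        exact sub_eq_zero.mp ((mul_eq_zero.mp e).resolve_left (by
          intro h; exact h2B (by linear_combination -h)))
      have hYB : Y ≠ B := by
        intro h; rw [h, sub_self, mul_zero] at key0
        exact hB (pow_eq_zero_iff two_ne_zero |>.mp ((mul_eq_zero.mp key0.symm).resolve_left h4))
      have key : (y₁ + B) * (2 * B) ^ 2 = (B - Y) * (-x₁) ^ 3 := by
        rw [neg_pow, show ((-1 : F)) ^ 3 = -1 by norm_num, ← hc₁]
        linear_combination -(y₁ + B) * key0
      rw [if_neg hy₁, if_pos hy₂, if_neg hYB, ← cubeClass_mul (hadd hy₁) h2B2, key,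
        cubeClass_mul_pow_three (sub_ne_zero.mpr (Ne.symm hYB)) (neg_ne_zero.mpr hx₁)]
    · /- `P`, `Q` generic -/
      rw [if_neg hy₁, if_neg hy₂]
      by_cases hYB : Y = B
      · /- `P + Q = −T'`: `(y₁ + B)(y₂ + B)(2B) = μ³` -/
        rw [if_pos hYB, ← cubeClass_mul (hadd hy₁) (hadd hy₂)]
        rw [hYB, show B + B = 2 * B by ring] at Cp
        have hμ : y₁ + B - ℓ * x₁ ≠ 0 := by
          intro h0
          rw [h0, zero_pow three_ne_zero, mul_eq_zero, mul_eq_zero] at Cp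
          rcases Cp with (h | h) | h
          · exact hadd hy₁ h
          · exact hadd hy₂ h
          · exact h2B h
        have key : (y₁ + B) * (y₂ + B) = (2 * B) ^ 2 * ((y₁ + B - ℓ * x₁) / (2 * B)) ^ 3 := by
          rw [div_pow, mul_div_assoc', eq_div_iff (pow_ne_zero 3 h2B)]
          linear_combination (2 * B) ^ 2 * Cp
        rw [key, cubeClass_mul_pow_three h2B2 (div_ne_zero hμ h2B)]
      · rw [if_neg hYB]
        by_cases hYB' : Y = -B
        · /- `P + Q = T'`: `(y₁ − B)(y₂ − B)(−2B) = μ'³`, and `(yᵢ + B)(yᵢ − B) = xᵢ³` -/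
          rw [hYB', show -B + -B = -2 * B by ring] at Cm
          rw [hYB'] at Cp ⊢
          have hy₁B : y₁ - B ≠ 0 := by
            intro h
            have hx : x₁ = 0 := x_eq_zero_of_y_eq hW h₁.left (Or.inr (by linear_combination h))
            -- then `Cp` reads `(2B)(y₂ + B)·0 = (2B − 0)³`
            rw [hx, show y₁ = B by linear_combination h] at Cp
            exact h2B (pow_eq_zero_iff three_ne_zero |>.mp (by linear_combination -Cp))
          have hy₂B : y₂ - B ≠ 0 := by
            intro h
            have hx : x₂ = 0 := x_eq_zero_of_y_eq hW h₂.left (Or.inr (by linear_combination h))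
            have hν : y₁ - ℓ * x₁ = B := by
              rw [hx, show y₂ = B by linear_combination h] at hline; linear_combination -hline
            have : (2 * B) ^ 3 = 0 := by
              have hμ : y₁ + B - ℓ * x₁ = 2 * B := by linear_combination hν
              rw [hμ] at Cp
              linear_combination -Cp
            exact h2B (pow_eq_zero_iff three_ne_zero |>.mp this)
          have hμ : y₁ + -B - ℓ * x₁ ≠ 0 := by
            intro h0
            rw [h0, zero_pow three_ne_zero, mul_eq_zero, mul_eq_zero] at Cm
            rcases Cm with (h | h) | h
            · exact hy₁B (by linear_combination h)
            · exact hy₂B (by linear_combination h)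
            · exact h2B (by linear_combination -h / 1)
          have hx₁ : x₁ ≠ 0 := by
            intro hx; apply hy₁B
            have := hc₁; rw [hx, zero_pow three_ne_zero, mul_eq_zero] at this
            exact this.resolve_left (hadd hy₁)
          have hx₂ : x₂ ≠ 0 := by
            intro hx; apply hy₂B
            have := hc₂; rw [hx, zero_pow three_ne_zero, mul_eq_zero] at this
            exact this.resolve_left (hadd hy₂)
          have key : (y₁ + B) * (y₂ + B) = (B - -B) * (-(x₁ * x₂) / (y₁ + -B - ℓ * x₁)) ^ 3 := by
            rw [div_pow, mul_div_assoc', eq_div_iff (pow_ne_zero 3 hμ)]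
            linear_combination (-(y₁ + B) * (y₂ + B)) * Cm + (-2 * B * (y₂ + B) * (y₂ - B)) * hc₁ +
              (-2 * B * x₁ ^ 3) * hc₂
          rw [← cubeClass_mul (hadd hy₁) (hadd hy₂), key, cubeClass_mul_pow_three
            (sub_ne_zero.mpr hBB) (div_ne_zero (neg_ne_zero.mpr (mul_ne_zero hx₁ hx₂)) hμ)]
        · /- everything generic: `(y₁ + B)(y₂ + B) = (B − Y)(−μ/x₃)³` -/
          have hYp : Y + B ≠ 0 := hadd hYB'
          have hYm : Y - B ≠ 0 := sub_ne_zero.mpr hYB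
          have hx₃0 : x₃ ≠ 0 := by
            intro h; rw [h, zero_pow three_ne_zero, mul_eq_zero] at hc₃
            rcases hc₃ with h' | h'
            · exact hYp h'
            · exact hYm h'
          have hμ : y₁ + B - ℓ * x₁ ≠ 0 := by
            intro h0
            rw [h0, zero_pow three_ne_zero, mul_eq_zero, mul_eq_zero] at Cp
            rcases Cp with (h | h) | h
            · exact hadd hy₁ h
            · exact hadd hy₂ h
            · exact hYp h
          have key : (y₁ + B) * (y₂ + B) = (B - Y) * (-(y₁ + B - ℓ * x₁) / x₃) ^ 3 := by
            rw [div_pow, mul_div_assoc', eq_div_iff (pow_ne_zero 3 hx₃0)]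
            linear_combination (Y - B) * Cp - (y₁ + B) * (y₂ + B) * hc₃
          rw [← cubeClass_mul (hadd hy₁) (hadd hy₂), key, cubeClass_mul_pow_three
            (sub_ne_zero.mpr (Ne.symm hYB)) (div_ne_zero (neg_ne_zero.mpr hμ) hx₃0)]


/-- `[δ(−P)] [δ(P)] = 1`. [folklore] -/
theorem cubicDescentClass_neg_mul (hW : W = mordellCurve (B ^ 2)) (h2 : (2 : F) ≠ 0) (hB : B ≠ 0)
    (P : W.toAffine.Point) : cubicDescentClass W B (-P) * cubicDescentClass W B P = 1 := by
  rw [← cubicDescentClass_add hW h2 hB, neg_add_cancel, cubicDescentClass_zero]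

/-- Points with the same descent class differ by a point of trivial class:
`[δ(P)] = [δ(Q)] ⇒ [δ(P − Q)] = 1`. [folklore] -/
theorem cubicDescentClass_sub_eq_one (hW : W = mordellCurve (B ^ 2)) (h2 : (2 : F) ≠ 0) (hB : B ≠ 0)
    {P Q : W.toAffine.Point} (h : cubicDescentClass W B P = cubicDescentClass W B Q) :
    cubicDescentClass W B (P - Q) = 1 := by
  rw [sub_eq_add_neg, cubicDescentClass_add hW h2 hB, h, CubeUnits.mul_comm]
  exact cubicDescentClass_neg_mul hW h2 hB Q

end Curve

/-! ## Exactness at `E'(F)`: classes dying in `Fˣ/Fˣ³` come from `φ(E(F))` (any characteristic `∤ 6`) -/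

section Exactness

variable {W W' : WeierstrassCurve F} {c θ : F}

/-- `γ ≠ γ'` for the explicit preimage (characteristic-free form of `preim_sub_ne_zero`:
`18 ≠ 0` in `F`; the cubic relation `(γ − γ')³ + 3X₀(γ − γ') − 18c = 0` of `preim_cubic` is
re-derived inline, that lemma being stated under `CharZero`). [folklore] -/
theorem preim_sub_ne_zero' (h18 : (18 : F) ≠ 0) (hc : c ≠ 0) {X₀ Y₀ γ : F} (hγ : γ ^ 3 = Y₀ + 9 * c)
    (hγ0 : γ ≠ 0) (hE' : Y₀ ^ 2 = X₀ ^ 3 + 81 * c ^ 2) : γ - X₀ / γ ≠ 0 := by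
  intro h0
  have hγ' : (X₀ / γ) ^ 3 = Y₀ - 9 * c := by
    rw [div_pow, div_eq_iff (pow_ne_zero 3 hγ0), hγ]
    linear_combination -hE'
  have hγγ' : γ * (X₀ / γ) = X₀ := mul_div_cancel₀ _ hγ0
  have : (γ - X₀ / γ) ^ 3 + 3 * X₀ * (γ - X₀ / γ) - 18 * c = 0 := by
    linear_combination hγ - hγ' - 3 * (γ - X₀ / γ) * hγγ'
  rw [h0] at this
  have h18c : (18 : F) * c = 0 := by linear_combination -this
  exact (mul_ne_zero h18 hc) h18c

/-- `x ≠ 0` for the explicit preimage (characteristic-free form). [folklore] -/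
theorem preimX_ne_zero' (h18 : (18 : F) ≠ 0) (hc : c ≠ 0) {X₀ Y₀ γ : F} (hγ : γ ^ 3 = Y₀ + 9 * c)
    (hγ0 : γ ≠ 0) (hE' : Y₀ ^ 2 = X₀ ^ 3 + 81 * c ^ 2) : preimX c X₀ γ ≠ 0 := by
  have h6 : (6 : F) ≠ 0 := fun h => h18 (by linear_combination (3 : F) * h)
  exact div_ne_zero (mul_ne_zero h6 hc) (preim_sub_ne_zero' h18 hc hγ hγ0 hE')

/-- **The explicit preimage lies on `W : y² = x³ − 3c²`** (characteristic-free form of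
`preim_equation`). [folklore] -/
theorem preim_equation' (h18 : (18 : F) ≠ 0) (hc : c ≠ 0) {X₀ Y₀ γ : F} (hγ : γ ^ 3 = Y₀ + 9 * c)
    (hγ0 : γ ≠ 0) (hE' : Y₀ ^ 2 = X₀ ^ 3 + 81 * c ^ 2) :
    preimY c X₀ γ ^ 2 = preimX c X₀ γ ^ 3 - 3 * c ^ 2 := by
  have hδ := preim_sub_ne_zero' h18 hc hγ hγ0 hE'
  have hγγ' : γ * (X₀ / γ) = X₀ := mul_div_cancel₀ _ hγ0
  have hcub : (γ - X₀ / γ) ^ 3 + 3 * X₀ * (γ - X₀ / γ) - 18 * c = 0 := by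
    have hγ' : (X₀ / γ) ^ 3 = Y₀ - 9 * c := by
      rw [div_pow, div_eq_iff (pow_ne_zero 3 hγ0), hγ]
      linear_combination -hE'
    linear_combination hγ - hγ' - 3 * (γ - X₀ / γ) * hγγ'
  have hx : preimX c X₀ γ * (γ - X₀ / γ) = 6 * c := by
    unfold preimX; exact div_mul_cancel₀ _ hδ
  unfold preimY
  have h3 : preimX c X₀ γ ^ 3 * ((γ - X₀ / γ) ^ 3 + 3 * X₀ * (γ - X₀ / γ) - 18 * c) = 0 := by
    rw [hcub, mul_zero]
  have h4 : preimX c X₀ γ ^ 3 * ((γ - X₀ / γ) ^ 3 + 3 * X₀ * (γ - X₀ / γ) - 18 * c) =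
      (preimX c X₀ γ * (γ - X₀ / γ)) ^ 3 + 3 * X₀ * preimX c X₀ γ ^ 2 * (preimX c X₀ γ * (γ - X₀ / γ)) -
        18 * c * preimX c X₀ γ ^ 3 := by
    ring
  rw [h4, hx] at h3
  have h5 : (18 * c) * (12 * c ^ 2 + X₀ * preimX c X₀ γ ^ 2 - preimX c X₀ γ ^ 3) = 0 := by
    linear_combination h3
  have h6 : 12 * c ^ 2 + X₀ * preimX c X₀ γ ^ 2 - preimX c X₀ γ ^ 3 = 0 :=
    (mul_eq_zero.mp h5).resolve_left (mul_ne_zero h18 hc)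
  linear_combination (γ * preimX c X₀ γ) * hx + preimX c X₀ γ ^ 2 * hγγ' + h6

/-- `g_c` of the explicit preimage is `γ` (characteristic-free form). [folklore] -/
theorem gFunW_preim' (h18 : (18 : F) ≠ 0) (hc : c ≠ 0) {X₀ Y₀ γ : F} (hγ : γ ^ 3 = Y₀ + 9 * c)
    (hγ0 : γ ≠ 0) (hE' : Y₀ ^ 2 = X₀ ^ 3 + 81 * c ^ 2)
    (h : W.toAffine.Nonsingular (preimX c X₀ γ) (preimY c X₀ γ)) :
    gFunW c (Affine.Point.some _ _ h) = γ := by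
  rw [gFunW_some, preimY, sub_add_cancel, mul_div_assoc, div_self (preimX_ne_zero' h18 hc hγ hγ0 hE'),
    mul_one]

/-- `g_{−c}` of the explicit preimage is `γ' = X₀/γ` (characteristic-free form). [folklore] -/
theorem gFunW_neg_preim' (h18 : (18 : F) ≠ 0) (hc : c ≠ 0) {X₀ Y₀ γ : F} (hγ : γ ^ 3 = Y₀ + 9 * c)
    (hγ0 : γ ≠ 0) (hE' : Y₀ ^ 2 = X₀ ^ 3 + 81 * c ^ 2)
    (h : W.toAffine.Nonsingular (preimX c X₀ γ) (preimY c X₀ γ)) :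
    gFunW (-c) (Affine.Point.some _ _ h) = X₀ / γ := by
  have hδ := preim_sub_ne_zero' h18 hc hγ hγ0 hE'
  have hx0 := preimX_ne_zero' h18 hc hγ hγ0 hE'
  have hx : preimX c X₀ γ * (γ - X₀ / γ) = 6 * c := by
    unfold preimX; exact div_mul_cancel₀ _ hδ
  rw [gFunW_some, preimY, div_eq_iff hx0]
  linear_combination hx

/-- **`φ` of the explicit preimage is `P' = (X₀, Y₀)`** (characteristic-free form of
`pointFun_preim`). [folklore] -/
theorem pointFun_preim' (hV : IsVeluThreePair 0 (c * θ) W W') (hθ : θ ^ 2 = -3) (h18 : (18 : F) ≠ 0)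
    (hc : c ≠ 0) {X₀ Y₀ γ : F} (hγ : γ ^ 3 = Y₀ + 9 * c) (hγ0 : γ ≠ 0)
    (hE' : Y₀ ^ 2 = X₀ ^ 3 + 81 * c ^ 2)
    (h : W.toAffine.Nonsingular (preimX c X₀ γ) (preimY c X₀ γ)) (h' : W'.toAffine.Nonsingular X₀ Y₀) :
    hV.pointFun (Affine.Point.some _ _ h) = Affine.Point.some X₀ Y₀ h' := by
  have hx0 := preimX_ne_zero' h18 hc hγ hγ0 hE'
  rw [hV.pointFun_some _ hx0]
  simp only [Affine.Point.some.injEq]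
  constructor
  · rw [← gFunW_mul_gFunW_neg hV hθ h hx0, gFunW_preim' h18 hc hγ hγ0 hE', gFunW_neg_preim' h18 hc hγ hγ0 hE',
      mul_div_cancel₀ _ hγ0]
  · have h3 := gFunW_pow_three hV hθ (e := c) rfl h hx0
    rw [gFunW_preim' h18 hc hγ hγ0 hE', hγ] at h3
    linear_combination -h3

/-- For a Vélu pair with parameters `(0, cθ)`, `θ² = −3`, the codomain IS `E'_{9c} : Y² = X³ + 81c²`.
[folklore] -/
theorem eq_mordellCurve_of_isVeluThreePair (hV : IsVeluThreePair 0 (c * θ) W W') (hθ : θ ^ 2 = -3) :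
    W' = mordellCurve ((9 * c) ^ 2) := by
  obtain ⟨_, _, _, _, _, h₁, h₂, h₃, h₄, h₆, _⟩ := hV
  ext
  · rw [h₁]; rfl
  · rw [h₂, mordellCurve_a₂]; ring
  · rw [h₃]; rfl
  · rw [h₄, mordellCurve_a₄]; ring
  · rw [h₆, mordellCurve_a₆]; linear_combination (-27 * c ^ 2) * hθ

/-- For a Vélu pair with parameters `(0, cθ)`, `θ² = −3`, the domain IS `E_{−3c²} : y² = x³ − 3c²`.
[folklore] -/
theorem eq_mordellCurve_of_isVeluThreePair' (hV : IsVeluThreePair 0 (c * θ) W W') (hθ : θ ^ 2 = -3) :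
    W = mordellCurve (-3 * c ^ 2) := by
  obtain ⟨h₁, h₂, h₃, h₄, h₆, _, _, _, _, _, _⟩ := hV
  ext
  · rw [h₁]; rfl
  · rw [h₂, mordellCurve_a₂]; ring
  · rw [h₃]; rfl
  · rw [h₄, mordellCurve_a₄]; ring
  · rw [h₆, mordellCurve_a₆]; linear_combination c ^ 2 * hθ

/-- **Exactness at `E'(F)`.** If the descent class of `P' ∈ E'(F)` is trivial then `P' = φ(P)` for
some `P ∈ E(F)` — the kernel of `δ : E'(F) → Fˣ/Fˣ³` is `φ(E(F))` (inclusion `⊆`; valid in any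
characteristic `∤ 6`, given `θ = √−3 ∈ F` for the Vélu pair): `O = φ(O)`; `−T' = φ(x, −3c)` with
`x³ = 12c² = (18c)²/27`; otherwise `Y + 9c = w³` and `P' = φ` of the explicit preimage
(`pointFun_preim'`). [cite: Cassels1964ArithmeticVI, p. 65] -/
theorem exists_pointFun_eq_of_cubicDescentClass_eq_one (hV : IsVeluThreePair 0 (c * θ) W W')
    (hθ : θ ^ 2 = -3) (h2 : (2 : F) ≠ 0) (h3 : (3 : F) ≠ 0) (hc : c ≠ 0) (P' : W'.toAffine.Point)
    (h1 : cubicDescentClass W' (9 * c) P' = 1) : ∃ P : W.toAffine.Point, hV.pointFun P = P' := by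
  have h18 : (18 : F) ≠ 0 := by
    rw [show (18 : F) = 2 * 3 * 3 by norm_num]; exact mul_ne_zero (mul_ne_zero h2 h3) h3
  have hW' := eq_mordellCurve_of_isVeluThreePair hV hθ
  have hWeq := hV.equation_iff
  rcases P' with _ | ⟨X, Y, hP⟩
  · exact ⟨0, hV.pointFun_zero⟩
  have hE' : Y ^ 2 = X ^ 3 + 81 * c ^ 2 := by
    have := (equation_iff_of_eq hW' X Y).mp hP.left; linear_combination this
  rw [cubicDescentClass, cubicDescent_some] at h1
  by_cases hY : Y = -(9 * c)
  · /- `P' = −T'`: `(18c)² = w³`, so `12c² = (w/3)³` and `(w/3, −3c) ↦ −T'` -/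
    rw [if_pos hY] at h1
    obtain ⟨w, hw, hw3⟩ := (cubeClass_eq_one_iff (pow_ne_zero 2 (mul_ne_zero h2 (mul_ne_zero
      (by rw [show (9 : F) = 3 * 3 by norm_num]; exact mul_ne_zero h3 h3) hc)))).mp h1
    have hX : X = 0 := by
      have : X ^ 3 = 0 := by rw [hY] at hE'; linear_combination -hE'
      exact pow_eq_zero_iff three_ne_zero |>.mp this
    have hx3 : (w / 3) ^ 3 = 12 * c ^ 2 := by
      rw [div_pow, div_eq_iff (pow_ne_zero 3 h3)]; linear_combination -hw3
    have hx0 : w / 3 ≠ 0 := div_ne_zero hw h3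
    have hEq : W.toAffine.Equation (w / 3) (-(3 * c)) := by
      rw [hWeq]; linear_combination -hx3 - c ^ 2 * hθ
    have hns : W.toAffine.Nonsingular (w / 3) (-(3 * c)) :=
      (Affine.equation_iff_nonsingular_of_Δ_ne_zero hV.Δ_ne).mp hEq
    refine ⟨Affine.Point.some _ _ hns, ?_⟩
    rw [hV.pointFun_some _ hx0]
    refine point_some_ext ?_ ?_
    · rw [IsVeluPair.X_eq' hV hθ, hX, hx3, sub_self, zero_div]
    · rw [IsVeluPair.Y_eq' hV hθ, hx3, hY, div_eq_iff (mul_ne_zero (by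
        rw [show (12 : F) = 2 * 2 * 3 by norm_num]; exact mul_ne_zero (mul_ne_zero h2 h2) h3)
        (pow_ne_zero 2 hc))]
      ring
  · /- generic: `Y + 9c = w³`, the explicit preimage -/
    rw [if_neg hY] at h1
    have hY9 : Y + 9 * c ≠ 0 := fun h => hY (by linear_combination h)
    obtain ⟨w, hw, hw3⟩ := (cubeClass_eq_one_iff hY9).mp h1
    have hγ : w ^ 3 = Y + 9 * c := hw3.symm
    have hEq : W.toAffine.Equation (preimX c X w) (preimY c X w) := by
      rw [IsVeluPair.equation_iff' hV hθ]
      exact preim_equation' h18 hc hγ hw hE'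
    have hns := (Affine.equation_iff_nonsingular_of_Δ_ne_zero hV.Δ_ne).mp hEq
    exact ⟨_, pointFun_preim' hV hθ h18 hc hγ hw hE' hns hP⟩

end Exactness

/-! ## Bridge to `phiDescent` of the kernel file -/

section Bridge

variable {K : Type u} [Field K]

/-- **`phiDescent c = cubicDescent (9c)`** on `E' = mordellCurve (81c²)`: the two descent maps
agree (`O ↦ 1`; `(X, Y) ↦ Y + 9c` for `Y ≠ −9c`; at `−T'` the values `(18c)²` and `(2·9c)²` are
equal; no hypothesis on the characteristic). [folklore] -/
theorem phiDescent_eq_cubicDescent (c : K) (P : (mordellCurve (81 * c ^ 2)).toAffine.Point) :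
    phiDescent c P = cubicDescent (mordellCurve (81 * c ^ 2)) (9 * c) P := by
  rcases P with _ | ⟨X, Y, h⟩
  · rfl
  · rw [phiDescent_some, cubicDescent_some]
    split_ifs
    · ring
    · rfl

/-- The same at the level of classes: `[phiDescent c P] = cubicDescentClass (9c) P`. [folklore] -/
theorem cubeClass_phiDescent (c : K) (P : (mordellCurve (81 * c ^ 2)).toAffine.Point) :
    cubeClass (phiDescent c P) = cubicDescentClass (mordellCurve (81 * c ^ 2)) (9 * c) P := by
  rw [phiDescent_eq_cubicDescent]; rfl

/-- **Consequence: over a field of characteristic `0` the descent values form a group.** If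
`phiDescent c P = a u³` and `phiDescent c Q = b v³` (`u, v ≠ 0`) then `phiDescent c (P + Q) = a b w³`
for some `w ≠ 0` (`c ≠ 0`). [folklore] -/
theorem exists_phiDescent_add_eq [CharZero K] {c : K} (hc : c ≠ 0)
    {P Q : (mordellCurve (81 * c ^ 2)).toAffine.Point}
    {a b u v : K} (ha : a ≠ 0) (hb : b ≠ 0) (hu : u ≠ 0) (hv : v ≠ 0)
    (hP : phiDescent c P = a * u ^ 3) (hQ : phiDescent c Q = b * v ^ 3) :
    ∃ w : K, w ≠ 0 ∧ phiDescent c (P + Q) = a * b * w ^ 3 := by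
  have h9c : (9 : K) * c ≠ 0 := mul_ne_zero (by norm_num) hc
  have h2B : (2 : K) * (9 * c) ≠ 0 := mul_ne_zero two_ne_zero h9c
  have hW : mordellCurve (81 * c ^ 2) = mordellCurve ((9 * c) ^ 2) := by congr 1; ring
  have hadd := cubicDescentClass_add hW two_ne_zero h9c P Q
  rw [← cubeClass_phiDescent, ← cubeClass_phiDescent, ← cubeClass_phiDescent, hP, hQ,
    cubeClass_mul_pow_three ha hu, cubeClass_mul_pow_three hb hv, ← cubeClass_mul ha hb] at hadd
  have hne : phiDescent c (P + Q) ≠ 0 := by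
    rw [phiDescent_eq_cubicDescent]; exact cubicDescent_ne_zero h2B _
  exact (cubeClass_eq_cubeClass_iff hne (mul_ne_zero ha hb)).mp hadd

end Bridge

end MordellDescent

end Literature.NumberTheory.EllipticCurves

end
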